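import Summits.Ventures.CertifiedArithmetic.LowPrec.OptTreePolyFormats

/-!
# T4(b) in the named formats: up to which tree height is the tree-polynomial bound attained?

HONEST FRAMING (venture CertifiedArithmetic / cell `pub-lowprec`): certified error envelopes and
provably optimal rounding/accumulation schemes for low-precision formats under stated cost models;
every table by two implementations; no hardware or vendor claims.

`OptTreePolyFormats.treePoly_attained_format` realises the opt seat's witness of a tree `t` as
genuine data of a format `α` whenever the exponent range has room for it: `qexp α + p·height t ≤ e`
and `2^e (1+u) ≤ maxRat α`. This file fixes, for each named format of the bundle, the largest
admissible scale `2^E` and turns the side condition into a plain bound on the HEIGHT of the tree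
(`attained_of_height_le` + one `decide` per format):

| format   | `p` | `qexp` | `E` | bound attained for every tree of height `≤` |
|----------|-----|--------|-----|------|
| E2M1     | 2   | −1     | 2   | 1    |
| E3M2     | 3   | −4     | 4   | 2    |
| E2M3     | 4   | −3     | 2   | 1    |
| E4M3     | 4   | −9     | 8   | 4    |
| E5M2     | 3   | −16    | 15  | 10   |
| binary16 | 11  | −24    | 15  | 3    |
| bfloat16 | 8   | −133   | 127 | 32   |
| binary32 | 24  | −149   | 127 | 11   |

So, e.g., in E4M3 the exact worst-case relative under-estimation of EVERY summation tree of height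
`≤ 4` (all balanced trees on `≤ 16` leaves, chains on `≤ 5`) over nonnegative in-range data is
EXACTLY `1 - 1/M_t(1/16)`; in bfloat16 this covers every tree of height `≤ 32`, in binary16 only
height `≤ 3` (its exponent range is the binding constraint, not its precision). Beyond these
heights the upper bound `exact_sub_eval_le_format` still holds for every tree; whether it is
attained there is not decided here (the witness needs `p` binades per level).
-/

namespace Summit.Ventures.CertifiedArithmetic.LowPrec.Opt

open Literature.ComputerArithmetic.JeannerodRump2018
open Literature.ComputerArithmetic.JeannerodRump2018.SumTree
open Literature.ComputerArithmetic.FloatingPoint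
open Literature.ComputerArithmetic.FloatingPoint.MiniFloat

/-- Generic height form of T4(b) in a format: if the scale `2^E` fits (`2^E(1+u) ≤ maxRat`) and
leaves `p·H` binades above the quantum (`qexp + p·H ≤ E`), then for EVERY tree of height `≤ H`
there is in-range nonnegative data of `α` of the same tree polynomial, positive sum, on which the
format under-estimates by exactly `(1 - 1/M_t(u_α))·exact`. -/
theorem attained_of_height_le (α : Format) (hm : 1 ≤ α.manBits) (E : ℤ) (H : ℕ)
    (hE : (2 : ℚ) ^ E * (1 + α.unitRoundoff) ≤ α.maxRat)
    (hH : α.qexp + (((α.manBits + 1) * H : ℕ) : ℤ) ≤ E) (t : SumTree) (ht : height t ≤ H) :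
    ∃ w : SumTree, treeM α.unitRoundoff w = treeM α.unitRoundoff t ∧ TreeInRange α w ∧
      (∀ x ∈ leaves w, 0 ≤ x) ∧ 0 < exact w ∧
      exact w - eval (flα α) w = (1 - 1 / treeM α.unitRoundoff t) * exact w := by
  have he : α.qexp + (((α.manBits + 1) * height t : ℕ) : ℤ) ≤ E := by
    have h1 : (α.manBits + 1) * height t ≤ (α.manBits + 1) * H := Nat.mul_le_mul_left _ ht
    have h2 : (((α.manBits + 1) * height t : ℕ) : ℤ) ≤ (((α.manBits + 1) * H : ℕ) : ℤ) := by
      exact_mod_cast h1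
    omega
  obtain ⟨hin, hpos, hM, -, hexact, hatt⟩ := treePoly_attained_format hm t he hE
  have hMt : 1 ≤ treeM α.unitRoundoff t := one_le_treeM (format_unitRoundoff_nonneg α) t
  exact ⟨_, hM, hin, hpos, by rw [hexact]; exact mul_pos (zpow_pos (by norm_num) E) (by linarith), hatt⟩

/-- E4M3 (`u = 1/16`, `qexp = -9`): attained at scale `2^8` for every tree of height `≤ 4`. -/
theorem attained_E4M3 (t : SumTree) (ht : height t ≤ 4) :
    ∃ w : SumTree, treeM Format.E4M3.unitRoundoff w = treeM Format.E4M3.unitRoundoff t ∧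
      TreeInRange Format.E4M3 w ∧ (∀ x ∈ leaves w, 0 ≤ x) ∧ 0 < exact w ∧
      exact w - eval (flα Format.E4M3) w = (1 - 1 / treeM Format.E4M3.unitRoundoff t) * exact w :=
  attained_of_height_le Format.E4M3 (by decide) 8 4 (by decide +kernel) (by decide) t ht

/-- E5M2 (`u = 1/8`, `qexp = -16`): attained at scale `2^15` for every tree of height `≤ 10`. -/
theorem attained_E5M2 (t : SumTree) (ht : height t ≤ 10) :
    ∃ w : SumTree, treeM Format.E5M2.unitRoundoff w = treeM Format.E5M2.unitRoundoff t ∧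
      TreeInRange Format.E5M2 w ∧ (∀ x ∈ leaves w, 0 ≤ x) ∧ 0 < exact w ∧
      exact w - eval (flα Format.E5M2) w = (1 - 1 / treeM Format.E5M2.unitRoundoff t) * exact w :=
  attained_of_height_le Format.E5M2 (by decide) 15 10 (by decide +kernel) (by decide) t ht

/-- E2M1 / FP4 (`u = 1/4`, `qexp = -1`, `maxRat = 6`): attained at scale `2^2` for every tree of
height `≤ 1` only — `(4, 1) ↦ 4` for the exact `5`. -/
theorem attained_E2M1 (t : SumTree) (ht : height t ≤ 1) :
    ∃ w : SumTree, treeM Format.E2M1.unitRoundoff w = treeM Format.E2M1.unitRoundoff t ∧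
      TreeInRange Format.E2M1 w ∧ (∀ x ∈ leaves w, 0 ≤ x) ∧ 0 < exact w ∧
      exact w - eval (flα Format.E2M1) w = (1 - 1 / treeM Format.E2M1.unitRoundoff t) * exact w :=
  attained_of_height_le Format.E2M1 (by decide) 2 1 (by decide +kernel) (by decide) t ht

/-- E3M2 / FP6 (`u = 1/8`, `qexp = -4`, `maxRat = 28`): attained at scale `2^4` for every tree of
height `≤ 2`. -/
theorem attained_E3M2 (t : SumTree) (ht : height t ≤ 2) :
    ∃ w : SumTree, treeM Format.E3M2.unitRoundoff w = treeM Format.E3M2.unitRoundoff t ∧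
      TreeInRange Format.E3M2 w ∧ (∀ x ∈ leaves w, 0 ≤ x) ∧ 0 < exact w ∧
      exact w - eval (flα Format.E3M2) w = (1 - 1 / treeM Format.E3M2.unitRoundoff t) * exact w :=
  attained_of_height_le Format.E3M2 (by decide) 4 2 (by decide +kernel) (by decide) t ht

/-- E2M3 / FP6 (`u = 1/16`, `qexp = -3`, `maxRat = 7.5`): attained at scale `2^2` for every tree of
height `≤ 1`. -/
theorem attained_E2M3 (t : SumTree) (ht : height t ≤ 1) :
    ∃ w : SumTree, treeM Format.E2M3.unitRoundoff w = treeM Format.E2M3.unitRoundoff t ∧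
      TreeInRange Format.E2M3 w ∧ (∀ x ∈ leaves w, 0 ≤ x) ∧ 0 < exact w ∧
      exact w - eval (flα Format.E2M3) w = (1 - 1 / treeM Format.E2M3.unitRoundoff t) * exact w :=
  attained_of_height_le Format.E2M3 (by decide) 2 1 (by decide +kernel) (by decide) t ht

/-- binary16 (`u = 2⁻¹¹`, `qexp = -24`, `maxRat = 65504`): attained at scale `2^15` for every tree
of height `≤ 3` — the narrow exponent range, not the precision, is binding. -/
theorem attained_Binary16 (t : SumTree) (ht : height t ≤ 3) :
    ∃ w : SumTree, treeM Format.Binary16.unitRoundoff w = treeM Format.Binary16.unitRoundoff t ∧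
      TreeInRange Format.Binary16 w ∧ (∀ x ∈ leaves w, 0 ≤ x) ∧ 0 < exact w ∧
      exact w - eval (flα Format.Binary16) w
        = (1 - 1 / treeM Format.Binary16.unitRoundoff t) * exact w :=
  attained_of_height_le Format.Binary16 (by decide) 15 3 (by decide +kernel) (by decide) t ht

/-- bfloat16 (`u = 2⁻⁸`, `qexp = -133`): attained at scale `2^127` for every tree of height `≤ 32`
(every balanced tree on up to `2^32` leaves, every chain on `≤ 33` summands). -/
theorem attained_BFloat16 (t : SumTree) (ht : height t ≤ 32) :
    ∃ w : SumTree, treeM Format.BFloat16.unitRoundoff w = treeM Format.BFloat16.unitRoundoff t ∧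
      TreeInRange Format.BFloat16 w ∧ (∀ x ∈ leaves w, 0 ≤ x) ∧ 0 < exact w ∧
      exact w - eval (flα Format.BFloat16) w
        = (1 - 1 / treeM Format.BFloat16.unitRoundoff t) * exact w :=
  attained_of_height_le Format.BFloat16 (by decide) 127 32 (by decide +kernel) (by decide) t ht

/-- binary32 (`u = 2⁻²⁴`, `qexp = -149`): attained at scale `2^127` for every tree of height
`≤ 11`. -/
theorem attained_Binary32 (t : SumTree) (ht : height t ≤ 11) :
    ∃ w : SumTree, treeM Format.Binary32.unitRoundoff w = treeM Format.Binary32.unitRoundoff t ∧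
      TreeInRange Format.Binary32 w ∧ (∀ x ∈ leaves w, 0 ≤ x) ∧ 0 < exact w ∧
      exact w - eval (flα Format.Binary32) w
        = (1 - 1 / treeM Format.Binary32.unitRoundoff t) * exact w :=
  attained_of_height_le Format.Binary32 (by decide) 127 11 (by decide +kernel) (by decide) t ht

/-- The table's scales are maximal and the heights are the corresponding ceilings: one more unit
of height violates `qexp + p·(H+1) ≤ E`, and the next scale `2^(E+1)(1+u)` exceeds `maxRat`
(E4M3, binary16, E2M1 shown; kernel arithmetic). -/
theorem height_table_ceilings :
    ¬ (Format.E4M3.qexp + (((Format.E4M3.manBits + 1) * 5 : ℕ) : ℤ) ≤ 8) ∧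
    ¬ ((2 : ℚ) ^ (9 : ℤ) * (1 + Format.E4M3.unitRoundoff) ≤ Format.E4M3.maxRat) ∧
    ¬ (Format.Binary16.qexp + (((Format.Binary16.manBits + 1) * 4 : ℕ) : ℤ) ≤ 15) ∧
    ¬ ((2 : ℚ) ^ (16 : ℤ) * (1 + Format.Binary16.unitRoundoff) ≤ Format.Binary16.maxRat) ∧
    ¬ (Format.E2M1.qexp + (((Format.E2M1.manBits + 1) * 2 : ℕ) : ℤ) ≤ 2) ∧
    ¬ ((2 : ℚ) ^ (3 : ℤ) * (1 + Format.E2M1.unitRoundoff) ≤ Format.E2M1.maxRat) := by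
  refine ⟨by decide, by decide +kernel, by decide, by decide +kernel, by decide, by decide +kernel⟩

end Summit.Ventures.CertifiedArithmetic.LowPrec.Opt
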